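import Summits.AtomisticToContinuum.BoseEinsteinCondensation.Theorems.GroundStateRigidity.Negative.TwoHardSpheresSupport
import HarnessLib

/-!
# Two unit hard spheres in a small box: localisation of a finite-energy state to the class `{q > 0}`

`GroundStateRigidity` (crux stmt-AtomisticToContinuum-9072, shared by 8 routes of `BoseEinsteinCondensation`):
negative-side support, third of the four files
`Negative/BoxReflection.lean` → `Negative/TwoHardSpheresSupport.lean` → `Negative/TwoHardSpheresLocalisation.lean`
→ `Negative/TwoHardSpheres.lean` (kernel-checked by the crux disprover `refuter-cdisprove-stmt-AtomisticToContinuum-9072-0`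
as §4 of `Cruxes/GroundStateRigidity/Disproof.lean`, 2026-08-16; landed verbatim up to docstrings by the line lead c1).

This file (`N = 2`, `v = hardSphere`, box with `2L² < 1`, threshold `thr L = 1 - 2L²`): the `{q > 0}`-half mass
`halfMass Ψ = ∫ wt·|Ψ|²` and energy `halfEnergy Ψ = ∫ wt·(|∇Ψ|² + V|Ψ|²)` of a finite-energy two-body trial state;
the halves of `Ψ` and of its reflection `reflectTS Ψ` add up to the full mass `1` and the full energy (the state
vanishes with its derivative on `{|q| < thr L}`, and beyond the threshold the two weights are complementary); the
normalised localised state `locTS Ψ = m^{-1/2}·cut·Ψ` is an admissible trial state with energy `m⁻¹·halfEnergy Ψ`,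
supported in `{q > thr L}`; whence the variational bound `halfMass Ψ · E₀ ≤ halfEnergy Ψ`.
-/

noncomputable section

namespace Summit.AtomisticToContinuum.BoseEinsteinCondensation.Theorems.GroundStateRigidity.Negative.TwoHardSpheres

open Literature.MathematicalPhysics.QuantumManyBody.BoseGas
open MeasureTheory Filter Metric
open scoped ENNReal NNReal Topology

variable {N : ℕ}

/-! ### Masses and energies of the two halves -/

/-- abbreviation: the threshold `g = 1 - 2L²` -/
def thr (L : ℝ) : ℝ := 1 - 2 * L ^ 2

/-- energy density of a state -/
def edens (v : ℝ → ℝ≥0∞) {L : ℝ} (Ψ : TrialState N L) (X : Config N) : ℝ≥0∞ :=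
  kineticDensity Ψ.ψ X + interaction v X * (‖Ψ.ψ X‖₊ : ℝ≥0∞) ^ 2

/-- The energy is the integral of the energy density (definitional). -/
theorem energy_eq_lintegral_edens (v : ℝ → ℝ≥0∞) {L : ℝ} (Ψ : TrialState N L) :
    energy v Ψ = ∫⁻ X, edens v Ψ X := rfl

/-- The energy density of the reflected state is the reflected energy density. -/
theorem edens_reflectTS (v : ℝ → ℝ≥0∞) {L : ℝ} (Ψ : TrialState N L) (X : Config N) :
    edens v (reflectTS Ψ) X = edens v Ψ (reflC L X) := by
  unfold edens
  show kineticDensity (fun Y => Ψ.ψ (reflC L Y)) X + interaction v X * _ = _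
  rw [kineticDensity_comp_reflC Ψ.contDiff, interaction_reflC]
  rfl

/-- mass of the `{q > 0}` half -/
def halfMass {L : ℝ} (Ψ : TrialState 2 L) : ℝ≥0∞ := ∫⁻ X, wt (thr L) X * (‖Ψ.ψ X‖₊ : ℝ≥0∞) ^ 2

/-- energy of the `{q > 0}` half -/
def halfEnergy {L : ℝ} (Ψ : TrialState 2 L) : ℝ≥0∞ := ∫⁻ X, wt (thr L) X * edens hardSphere Ψ X

/-- pointwise splitting of any density vanishing on `{|q| < g}` -/
theorem split_pointwise {L : ℝ} (hL : 2 * L ^ 2 < 1) {F : Config 2 → ℝ≥0∞}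
    (hF : ∀ X, |qfun X| < thr L → F X = 0) (X : Config 2) :
    wt (thr L) X * F X + wt (thr L) (reflC L X) * F X = F X := by
  have hg : 0 < thr L := by unfold thr; linarith
  by_cases hq : |qfun X| < thr L
  · simp [hF X hq]
  · rw [← add_mul, wt_add_wt_reflC hg (not_lt.1 hq), one_mul]

/-- The `{q > 0}`-masses of a finite-energy state and of its reflection add up to `1`. -/
theorem halfMass_add {L : ℝ} (hL : 2 * L ^ 2 < 1) (Ψ : TrialState 2 L)
    (hE : energy hardSphere Ψ ≠ ⊤) : halfMass Ψ + halfMass (reflectTS Ψ) = 1 := by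
  have hF : ∀ X, |qfun X| < thr L → (‖Ψ.ψ X‖₊ : ℝ≥0∞) ^ 2 = 0 := by
    intro X hX
    have : Ψ.ψ X = 0 := by
      by_contra h
      exact absurd (lt_abs_qfun_of_ne_zero Ψ hE h) (not_lt.2 hX.le)
    simp [this]
  have h2 : halfMass (reflectTS Ψ) = ∫⁻ X, wt (thr L) (reflC L X) * (‖Ψ.ψ X‖₊ : ℝ≥0∞) ^ 2 := by
    unfold halfMass
    rw [← lintegral_comp_reflC L (fun X => wt (thr L) (reflC L X) * (‖Ψ.ψ X‖₊ : ℝ≥0∞) ^ 2)]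
    refine lintegral_congr fun X => ?_
    simp [reflC_reflC]
  have hm : Measurable fun X => wt (thr L) X * (‖Ψ.ψ X‖₊ : ℝ≥0∞) ^ 2 := by
    refine Measurable.mul ?_ ((Ψ.contDiff.continuous.measurable.nnnorm.coe_nnreal_ennreal).pow_const 2)
    exact ((contDiff_cut _).continuous.measurable.nnnorm.coe_nnreal_ennreal).pow_const 2
  rw [h2, halfMass, ← lintegral_add_left hm]
  rw [← Ψ.norm_eq]
  exact lintegral_congr fun X => split_pointwise hL hF X

/-- The `{q > 0}`-energies of a finite-energy state and of its reflection add up to the energy. -/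
theorem halfEnergy_add {L : ℝ} (hL : 2 * L ^ 2 < 1) (Ψ : TrialState 2 L)
    (hE : energy hardSphere Ψ ≠ ⊤) :
    halfEnergy Ψ + halfEnergy (reflectTS Ψ) = energy hardSphere Ψ := by
  have hF : ∀ X, |qfun X| < thr L → edens hardSphere Ψ X = 0 := by
    intro X hX
    have h0 : Ψ.ψ X = 0 := by
      by_contra h
      exact absurd (lt_abs_qfun_of_ne_zero Ψ hE h) (not_lt.2 hX.le)
    simp [edens, h0, kineticDensity_eq_zero_of_abs_qfun_lt Ψ hE hX]
  have h2 : halfEnergy (reflectTS Ψ) = ∫⁻ X, wt (thr L) (reflC L X) * edens hardSphere Ψ X := by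
    unfold halfEnergy
    rw [← lintegral_comp_reflC L (fun X => wt (thr L) (reflC L X) * edens hardSphere Ψ X)]
    refine lintegral_congr fun X => ?_
    rw [reflC_reflC, edens_reflectTS]
  have hm : Measurable fun X => wt (thr L) X * edens hardSphere Ψ X := by
    refine Measurable.mul ?_ ?_
    · exact ((contDiff_cut _).continuous.measurable.nnnorm.coe_nnreal_ennreal).pow_const 2
    · exact measurable_energyDensity isRepulsiveFiniteRange_hardSphere.1 Ψ.contDiff.continuous
  rw [h2, halfEnergy, ← lintegral_add_left hm, energy_eq_lintegral_edens]
  exact lintegral_congr fun X => split_pointwise hL hF X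


/-! ### The normalised localised state and its energy -/

/-- **Localisation to the class `{q > 0}`** of a finite-energy two-body state with positive
`{q > 0}`-mass `m`: `m^{-1/2} · step(q) · Ψ`, an admissible trial state. -/
def locTS {L : ℝ} (Ψ : TrialState 2 L) (hm0 : halfMass Ψ ≠ 0) : TrialState 2 L where
  ψ X := ((Real.sqrt ((halfMass Ψ).toReal)⁻¹ : ℝ) : ℂ) * (cut (thr L) X * Ψ.ψ X)
  contDiff := contDiff_const.mul ((contDiff_cut _).mul Ψ.contDiff)
  eq_zero X hX := by simp [Ψ.eq_zero X hX]
  symm σ X := by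
    show _ = _
    simp only [cut, qfun_comp_perm, Ψ.symm]
  norm_eq := by
    have hm1 : halfMass Ψ ≤ 1 := by
      calc halfMass Ψ ≤ ∫⁻ X, 1 * (‖Ψ.ψ X‖₊ : ℝ≥0∞) ^ 2 :=
            lintegral_mono fun X => mul_le_mul' (wt_le_one _ _) le_rfl
        _ = 1 := by simp [Ψ.norm_eq]
    have hmt : halfMass Ψ ≠ ⊤ := ne_top_of_le_ne_top ENNReal.one_ne_top hm1
    have hpos : 0 < (halfMass Ψ).toReal := ENNReal.toReal_pos hm0 hmt
    simp only [ennorm_real_mul_sq _ (Real.sqrt_nonneg _), nnnorm_cut_mul_sq]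
    rw [lintegral_const_mul' _ _ ENNReal.ofReal_ne_top, Real.sq_sqrt (inv_nonneg.2 hpos.le),
      ENNReal.ofReal_inv_of_pos hpos, ENNReal.ofReal_toReal hmt]
    exact ENNReal.inv_mul_cancel hm0 hmt

/-- The wave function of the localised state (definitional). -/
theorem locTS_ψ {L : ℝ} (Ψ : TrialState 2 L) (hm0 : halfMass Ψ ≠ 0) (X : Config 2) :
    (locTS Ψ hm0).ψ X =
      ((Real.sqrt ((halfMass Ψ).toReal)⁻¹ : ℝ) : ℂ) * (cut (thr L) X * Ψ.ψ X) := rfl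

/-- The half mass is finite (at most the full mass `1`). -/
theorem halfMass_ne_top {L : ℝ} (Ψ : TrialState 2 L) : halfMass Ψ ≠ ⊤ := by
  have hm1 : halfMass Ψ ≤ 1 := by
    calc halfMass Ψ ≤ ∫⁻ X, 1 * (‖Ψ.ψ X‖₊ : ℝ≥0∞) ^ 2 :=
          lintegral_mono fun X => mul_le_mul' (wt_le_one _ _) le_rfl
      _ = 1 := by simp [Ψ.norm_eq]
  exact ne_top_of_le_ne_top ENNReal.one_ne_top hm1

/-- **Energy of the localised state**: `m⁻¹ ·` (energy of the `{q > 0}` half). -/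
theorem energy_locTS {L : ℝ} (hL : 2 * L ^ 2 < 1) (Ψ : TrialState 2 L)
    (hE : energy hardSphere Ψ ≠ ⊤) (hm0 : halfMass Ψ ≠ 0) :
    energy hardSphere (locTS Ψ hm0) = (halfMass Ψ)⁻¹ * halfEnergy Ψ := by
  have hmt := halfMass_ne_top Ψ
  have hpos : 0 < (halfMass Ψ).toReal := ENNReal.toReal_pos hm0 hmt
  have hc : ContDiff ℝ 1 fun X => cut (thr L) X * Ψ.ψ X := (contDiff_cut _).mul Ψ.contDiff
  unfold energy halfEnergy
  have hpt : ∀ X, kineticDensity (locTS Ψ hm0).ψ X +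
      interaction hardSphere X * (‖(locTS Ψ hm0).ψ X‖₊ : ℝ≥0∞) ^ 2 =
      ENNReal.ofReal ((Real.sqrt ((halfMass Ψ).toReal)⁻¹) ^ 2) *
        (wt (thr L) X * edens hardSphere Ψ X) := by
    intro X
    change kineticDensity (fun Y => ((Real.sqrt ((halfMass Ψ).toReal)⁻¹ : ℝ) : ℂ) *
        (cut (thr L) Y * Ψ.ψ Y)) X + interaction hardSphere X *
        (‖((Real.sqrt ((halfMass Ψ).toReal)⁻¹ : ℝ) : ℂ) * (cut (thr L) X * Ψ.ψ X)‖₊ : ℝ≥0∞) ^ 2 = _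
    rw [kineticDensity_const_mul hc _ (Real.sqrt_nonneg _), ennorm_real_mul_sq _ (Real.sqrt_nonneg _),
      nnnorm_cut_mul_sq]
    have hk : kineticDensity (fun Y => cut (thr L) Y * Ψ.ψ Y) X = wt (thr L) X * kineticDensity Ψ.ψ X :=
      kineticDensity_cut_mul hL Ψ hE X
    rw [hk, edens]
    ring
  simp_rw [hpt]
  rw [lintegral_const_mul' _ _ ENNReal.ofReal_ne_top, Real.sq_sqrt (inv_nonneg.2 hpos.le),
    ENNReal.ofReal_inv_of_pos hpos, ENNReal.ofReal_toReal hmt]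

/-- **Variational lower bound for a half**: `m · E₀ ≤` energy of the `{q > 0}` half. -/
theorem halfMass_mul_le_halfEnergy {L : ℝ} (hL : 2 * L ^ 2 < 1) (Ψ : TrialState 2 L)
    (hE : energy hardSphere Ψ ≠ ⊤) :
    halfMass Ψ * groundStateEnergy hardSphere 2 L ≤ halfEnergy Ψ := by
  by_cases hm0 : halfMass Ψ = 0
  · simp [hm0]
  · have hmt := halfMass_ne_top Ψ
    have h := groundStateEnergy_le_energy hardSphere (locTS Ψ hm0)
    rw [energy_locTS hL Ψ hE hm0] at h
    calc halfMass Ψ * groundStateEnergy hardSphere 2 L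
        ≤ halfMass Ψ * ((halfMass Ψ)⁻¹ * halfEnergy Ψ) := mul_le_mul' le_rfl h
      _ = halfEnergy Ψ := by rw [← mul_assoc, ENNReal.mul_inv_cancel hm0 hmt, one_mul]

/-- **Support of the localised state**: it lives where `q > g`. -/
theorem thr_lt_qfun_of_locTS_ne_zero {L : ℝ} (hL : 2 * L ^ 2 < 1) (Ψ : TrialState 2 L)
    (hE : energy hardSphere Ψ ≠ ⊤) (hm0 : halfMass Ψ ≠ 0) {X : Config 2}
    (hX : (locTS Ψ hm0).ψ X ≠ 0) : thr L < qfun X := by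
  have hg : 0 < thr L := by unfold thr; linarith
  rw [locTS_ψ] at hX
  have h1 : cut (thr L) X ≠ 0 := fun h => hX (by simp [h])
  have h2 : Ψ.ψ X ≠ 0 := fun h => hX (by simp [h])
  have hq : thr L < |qfun X| := lt_abs_qfun_of_ne_zero Ψ hE h2
  rcases lt_abs.1 hq with h | h
  · exact h
  · exfalso
    apply h1
    simp [cut, step_of_le_neg hg (by linarith : qfun X ≤ -thr L)]

end Summit.AtomisticToContinuum.BoseEinsteinCondensation.Theorems.GroundStateRigidity.Negative.TwoHardSpheres

end
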